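import Literature.Analysis.FluidPDE.PoincareHomotopyOperatorL2
import Literature.Analysis.FluidPDE.MollifiedField
import Literature.Analysis.FunctionSpaces.TimeMollification
import HarnessLib

/-!
# Every weakly divergence-free `L²_loc` field on `ℝ³` is a curl: the cone potential in `𝒟'`

Analysis/FluidPDE proofs file (no new definitions) over `PoincareHomotopyOperator.lean` /
`PoincareHomotopyOperatorL2.lean`. The smooth Poincaré lemma
`Literature.Analysis.FluidPDE.integral_inner_conePotential_curl` (Fonda 2018, Thm. 3.31:
`curl (∫₀¹ t f(tx) × x dt) = f` for solenoidal `C¹` fields) is extended to fields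
`f ∈ L²_loc(ℝ³; ℝ³)` which are divergence free in the sense of distributions
(`Fluid.IsWeaklyDivFree`):

* `integral_inner_conePotential_curl_of_isWeaklyDivFree`: `∫ ⟪conePotential f, curl Ψ⟫ = ∫ ⟪f, Ψ⟫`
  for every `Ψ ∈ C¹_c(ℝ³; ℝ³)` — i.e. `curl (conePotential f) = f` in `𝒟'(ℝ³)`. Proof by
  mollification: `fₙ = ρₙ ⋆ f` is smooth and *pointwise* divergence free
  (`Fluid.divergence_convolution_eq_zero`, `MollifiedField`), so the smooth identity applies to
  `fₙ`; `fₙ → f` in `L²(B_R)` (`Literature.Analysis.FunctionSpaces.tendsto_eLpNorm_normed_convolution_sub_self`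
  applied to the truncation `1_{B_{R+1}} f`, mollification being local), and
  `conePotential fₙ → conePotential f` in `L²(B_R)` by the bound
  `‖conePotential h‖_{L²(B_R)} ≤ 2R ‖h‖_{L²(B_R)}` (`lintegral_ball_enorm_conePotential_sq_le`); both
  sides of the identity pass to the limit.
* `isWeaklyDivFree_cutoff_conePotential`: for a smooth compactly supported cut-off `ζ`, the field
  `ζ f + ∇ζ × conePotential f` — formally `curl (ζ · conePotential f)` — is weakly divergence free:
  a *local, divergence-free cut-off of a divergence-free field*, an explicit and scaling-covariant
  alternative to the Bogovskiĭ correction `Φ₀` of `Z₀ f` in the printed proof of Bradshaw–Tsai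
  2019, Lemma 4.1 (arXiv:1801.08060, p. 11). (The tree discharges that lemma by a third route,
  averaging over linear changes of variables: `ForwardDSSApproximation.lean`,
  `Literature.Analysis.FluidPDE.bradshawTsai2019_lemma_4_1_holds`.)

Auxiliary (proved here): the algebra `curlCLM (ℓ ⊗ v) = ℓ♯ × v`, `⟪u, a × b⟫ = −⟪a × u, b⟫`;
`L²_loc ⊂ L¹_loc`; locality of mollification (`normed_convolution_congr_of_eqOn_ball`).

## References

* A. Fonda, *The Kurzweil–Henstock Integral for Undergraduates* (2018), Thm. 3.31 [Fonda2018].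
* Z. Bradshaw, T.-P. Tsai, Analysis & PDE 12 (2019) = arXiv:1801.08060, Lemma 4.1 and its proof
  (p. 11: "`∇·(Z₀ f) = f·∇Z₀` – i.e. `Z₀ f` is not divergence free. We can correct this using
  [Bogovskiĭ's] Lemma 4.2") [BradshawTsai2019].
* L. C. Evans, *Partial Differential Equations*, 2nd ed. (2010), App. C.4 Thm. 7 (mollifiers).
-/

noncomputable section

open MeasureTheory TopologicalSpace Set Function Filter Topology InnerProductSpace Metric
  ContinuousLinearMap
open scoped RealInnerProductSpace ENNReal NNReal Convolution Pointwise

namespace Literature.Analysis.FluidPDE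

/-- Local notation for physical space `ℝ³ = EuclideanSpace ℝ (Fin 3)`. -/
local notation "ℝ³" => EuclideanSpace ℝ (Fin 3)

/-! ## Algebra: rank-one curls and the scalar triple product -/

/-- `curlCLM (h ↦ (ℓ h) v) = ℓ♯ × v`: the curl of the rank-one Jacobian `ℓ ⊗ v` is the cross product
of the Riesz representative `ℓ♯ = ∇` of `ℓ` with `v` (the familiar `curl (ζ v) − ζ curl v = ∇ζ × v`,
Majda–Bertozzi §1.1, vector identities). [folklore] -/
theorem curlCLM_smulRight (ℓ : ℝ³ →L[ℝ] ℝ) (v : ℝ³) :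
    curlCLM (ℓ.smulRight v) = cross ((InnerProductSpace.toDual ℝ ℝ³).symm ℓ) v := by
  have hcoord : ∀ i : Fin 3, ((InnerProductSpace.toDual ℝ ℝ³).symm ℓ) i =
      ℓ (EuclideanSpace.single i 1) := fun i => by
    have h := InnerProductSpace.toDual_symm_apply (𝕜 := ℝ) (E := ℝ³) (x := EuclideanSpace.single i 1)
      (y := ℓ)
    rw [EuclideanSpace.inner_single_right] at h
    simpa using h
  ext i
  fin_cases i <;>
    simp [curlCLM, curlLM, cross, cross_apply, hcoord, mul_comm]

/-- The scalar triple product is alternating: `⟪u, a × b⟫ = −⟪a × u, b⟫`. [folklore] -/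
theorem inner_cross_right_eq_neg_inner_cross_left (u a b : ℝ³) :
    ⟪u, cross a b⟫ = -⟪cross a u, b⟫ := by
  simp only [cross, PiLp.inner_apply, cross_apply, RCLike.inner_apply,
    conj_trivial, Fin.sum_univ_three, Matrix.cons_val_zero, Matrix.cons_val_one,
    Matrix.cons_val_two, Matrix.head_cons, Matrix.tail_cons]
  ring

/-! ## `L²_loc ⊂ L¹_loc` and finite local `L²`-masses -/

section LocalIntegrability

variable {F : Type*} [NormedAddCommGroup F]

/-- A field with locally integrable `‖·‖²` has finite `L²`-mass on every ball. [folklore] -/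
theorem lintegral_ball_enorm_sq_lt_top_of_locallyIntegrable_sq {f : ℝ³ → F}
    (h : LocallyIntegrable (fun x => ‖f x‖ ^ 2) volume) (x₀ : ℝ³) (r : ℝ) :
    ∫⁻ x in ball x₀ r, ‖f x‖ₑ ^ 2 < ∞ := by
  have hint : IntegrableOn (fun x => ‖f x‖ ^ 2) (ball x₀ r) volume :=
    (h.integrableOn_isCompact (isCompact_closedBall x₀ r)).mono_set ball_subset_closedBall
  have hfin := hint.hasFiniteIntegral
  rw [hasFiniteIntegral_iff_enorm] at hfin
  refine lt_of_eq_of_lt (lintegral_congr fun x => ?_) hfin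
  rw [Real.enorm_eq_ofReal (sq_nonneg _), ENNReal.ofReal_pow (norm_nonneg _), ofReal_norm]

/-- **`L²_loc ⊂ L¹_loc`**: an a.e.-strongly measurable field with finite `L²`-mass on every ball
centred at the origin is locally integrable (Cauchy–Schwarz on balls). [folklore] -/
theorem locallyIntegrable_of_lintegral_ball_sq_lt_top {f : ℝ³ → F} (hf : AEStronglyMeasurable f volume)
    (h : ∀ R : ℝ, ∫⁻ x in ball (0 : ℝ³) R, ‖f x‖ₑ ^ 2 < ∞) : LocallyIntegrable f volume := by
  refine (locallyIntegrable_iff).2 fun K hK => ?_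
  obtain ⟨R, hR⟩ := hK.isBounded.subset_ball (0 : ℝ³)
  haveI : IsFiniteMeasure (volume.restrict (ball (0 : ℝ³) R)) :=
    isFiniteMeasure_restrict.2 measure_ball_lt_top.ne
  have h2 : MemLp f 2 (volume.restrict (ball (0 : ℝ³) R)) := by
    refine ⟨hf.restrict, ?_⟩
    rw [eLpNorm_lt_top_iff_lintegral_rpow_enorm_lt_top two_ne_zero ENNReal.ofNat_ne_top,
      ENNReal.toReal_ofNat]
    simp_rw [ENNReal.rpow_two]
    exact h R
  have h3 : IntegrableOn f (ball (0 : ℝ³) R) volume := h2.integrable one_le_two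
  exact h3.mono_set hR

/-- An a.e.-strongly measurable field with locally integrable `‖·‖²` is locally integrable. [folklore] -/
theorem locallyIntegrable_of_locallyIntegrable_sq {f : ℝ³ → F} (hf : AEStronglyMeasurable f volume)
    (h : LocallyIntegrable (fun x => ‖f x‖ ^ 2) volume) : LocallyIntegrable f volume :=
  locallyIntegrable_of_lintegral_ball_sq_lt_top hf fun R =>
    lintegral_ball_enorm_sq_lt_top_of_locallyIntegrable_sq h 0 R

end LocalIntegrability

/-! ## Locality of mollification -/

section Locality

variable {F : Type*} [NormedAddCommGroup F] [NormedSpace ℝ F]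

/-- **Mollification is local**: `(ρ ⋆ g)(x)` for a bump kernel `ρ = φ.normed` only sees `g` on the
ball `B(x, rOut φ)`; fields agreeing there have the same mollification at `x`
(Evans, App. C.4: `f^ε(x) = ∫_{B(0,ε)} η_ε(y) f(x − y) dy`). [folklore] -/
theorem normed_convolution_congr_of_eqOn_ball (φ : ContDiffBump (0 : ℝ³)) {g₁ g₂ : ℝ³ → F} {x : ℝ³}
    (h : ∀ y ∈ ball x φ.rOut, g₁ y = g₂ y) :
    (φ.normed volume ⋆[lsmul ℝ ℝ, volume] g₁) x = (φ.normed volume ⋆[lsmul ℝ ℝ, volume] g₂) x := by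
  simp only [convolution_def]
  refine integral_congr_ae (Eventually.of_forall fun t => ?_)
  dsimp only
  by_cases ht : t ∈ ball (0 : ℝ³) φ.rOut
  · have hxt : x - t ∈ ball x φ.rOut := by
      rw [mem_ball, dist_eq_norm, sub_sub_cancel_left, norm_neg]
      exact mem_ball_zero_iff.1 ht
    rw [h _ hxt]
  · have h0 : φ.normed volume t = 0 := by
      rw [← notMem_support, φ.support_normed_eq]
      exact ht
    simp [h0]

end Locality

/-! ## `curl (conePotential f) = f` in `𝒟'` for weakly divergence-free `L²_loc` fields -/

section Distributional

/-- A mollifier sequence with outer radii `1/(n+1) ≤ 1`, tending to `0` (the statement of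
`exists_contDiffBump_seq_le_one` in `NormalisedPressureDuality.lean`, restated here so as not to
import the pressure theory into this vector-calculus file). [folklore] -/
theorem exists_contDiffBump_seq_rOut_le_one :
    ∃ φ : ℕ → ContDiffBump (0 : ℝ³),
      Tendsto (fun n => (φ n).rOut) atTop (𝓝 0) ∧ ∀ n, (φ n).rOut ≤ 1 := by
  refine ⟨fun n => ⟨1 / ((n : ℝ) + 2), 1 / ((n : ℝ) + 1), by positivity, ?_⟩, ?_, fun n => ?_⟩
  · exact one_div_lt_one_div_of_lt (by positivity) (by linarith)
  · exact tendsto_one_div_add_atTop_nhds_zero_nat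
  · change 1 / ((n : ℝ) + 1) ≤ 1
    rw [div_le_one (by positivity)]
    linarith [n.cast_nonneg (α := ℝ)]

/-- `eLpNorm g 2 μ ≤ C^{1/2}` from `∫⁻ ‖g‖ₑ² ≤ C`. [folklore] -/
theorem eLpNorm_two_le_of_lintegral_sq_le {α : Type*} [MeasurableSpace α] {μ : Measure α}
    {F : Type*} [NormedAddCommGroup F] {g : α → F} {C : ℝ≥0∞}
    (h : ∫⁻ x, ‖g x‖ₑ ^ 2 ∂μ ≤ C) : eLpNorm g 2 μ ≤ C ^ (1 / (2 : ℝ)) := by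
  rw [eLpNorm_eq_lintegral_rpow_enorm_toReal two_ne_zero ENNReal.ofNat_ne_top, ENNReal.toReal_ofNat]
  simp_rw [ENNReal.rpow_two]
  exact ENNReal.rpow_le_rpow h (by norm_num)

/-- `(eLpNorm g 2 μ)² = ∫⁻ ‖g‖ₑ²`. [folklore] -/
theorem eLpNorm_two_pow_two {α : Type*} [MeasurableSpace α] {μ : Measure α}
    {F : Type*} [NormedAddCommGroup F] (g : α → F) :
    eLpNorm g 2 μ ^ 2 = ∫⁻ x, ‖g x‖ₑ ^ 2 ∂μ := by
  rw [eLpNorm_eq_lintegral_rpow_enorm_toReal two_ne_zero ENNReal.ofNat_ne_top, ENNReal.toReal_ofNat,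
    ← ENNReal.rpow_natCast, ← ENNReal.rpow_mul]
  simp_rw [ENNReal.rpow_two]
  norm_num

/-- **`L²(B_R)`-continuity of the cone potential**: if `fₙ → f` in `L²(B_R)` (balls centred at the
origin) then `conePotential fₙ → conePotential f` in `L²(B_R)`, for fields in `L²_loc` (so that
the potential is linear a.e.). [folklore] -/
theorem tendsto_eLpNorm_conePotential_sub {f : ℝ³ → ℝ³} {g : ℕ → ℝ³ → ℝ³}
    (hf : AEStronglyMeasurable f volume)
    (hf2 : ∀ R : ℝ, ∫⁻ x in ball (0 : ℝ³) R, ‖f x‖ₑ ^ 2 < ∞)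
    (hg : ∀ n, AEStronglyMeasurable (g n) volume)
    (hg2 : ∀ n, ∀ R : ℝ, ∫⁻ x in ball (0 : ℝ³) R, ‖g n x‖ₑ ^ 2 < ∞) {R : ℝ} (hR : 0 ≤ R)
    (hlim : Tendsto (fun n => eLpNorm (g n - f) 2 (volume.restrict (ball (0 : ℝ³) R))) atTop (𝓝 0)) :
    Tendsto (fun n => eLpNorm (conePotential (g n) - conePotential f) 2
      (volume.restrict (ball (0 : ℝ³) R))) atTop (𝓝 0) := by
  -- a.e. linearity
  have hae : ∀ n, conePotential (g n) - conePotential f =ᵐ[volume.restrict (ball (0 : ℝ³) R)]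
      conePotential (g n - f) := by
    intro n
    refine ae_restrict_of_ae ?_
    filter_upwards [ae_integrableOn_coneIntegrand hf hf2, ae_integrableOn_coneIntegrand (hg n) (hg2 n)]
      with x hx hgx
    rw [Pi.sub_apply, conePotential_sub hgx hx]
  -- the bound `‖K(gₙ − f)‖₂ ≤ 2R ‖gₙ − f‖₂`
  have hbound : ∀ n, eLpNorm (conePotential (g n) - conePotential f) 2
      (volume.restrict (ball (0 : ℝ³) R)) ≤
      (4 * ENNReal.ofReal (R ^ 2)) ^ (1 / (2 : ℝ)) *
        eLpNorm (g n - f) 2 (volume.restrict (ball (0 : ℝ³) R)) := by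
    intro n
    rw [eLpNorm_congr_ae (hae n)]
    have h1 := lintegral_ball_enorm_conePotential_sq_le ((hg n).sub hf) hR
    refine (eLpNorm_two_le_of_lintegral_sq_le h1).trans_eq ?_
    rw [ENNReal.mul_rpow_of_nonneg _ _ (by norm_num), ← eLpNorm_two_pow_two,
      ← ENNReal.rpow_natCast, ← ENNReal.rpow_mul]
    norm_num
  have hC : (4 * ENNReal.ofReal (R ^ 2)) ^ (1 / (2 : ℝ)) ≠ ∞ :=
    ENNReal.rpow_ne_top_of_nonneg (by norm_num)
      (ENNReal.mul_ne_top ENNReal.ofNat_ne_top ENNReal.ofReal_ne_top)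
  have hup : Tendsto (fun n => (4 * ENNReal.ofReal (R ^ 2)) ^ (1 / (2 : ℝ)) *
      eLpNorm (g n - f) 2 (volume.restrict (ball (0 : ℝ³) R))) atTop (𝓝 0) := by
    simpa using ENNReal.Tendsto.const_mul hlim (Or.inr hC)
  exact tendsto_of_tendsto_of_tendsto_of_le_of_le tendsto_const_nhds hup (fun n => zero_le) hbound

/-- Pairings against a fixed `L²` field are continuous under `L²` convergence:
`∫ ⟪uₙ, w⟫ → ∫ ⟪u, w⟫` if `‖uₙ − u‖_{L²(μ)} → 0` and `u, uₙ, w ∈ L²(μ)`. [folklore] -/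
theorem tendsto_integral_inner_of_tendsto_eLpNorm_sub {α : Type*} [MeasurableSpace α]
    {μ : Measure α} {u : ℕ → α → ℝ³} {u₀ w : α → ℝ³}
    (hu : ∀ n, AEStronglyMeasurable (u n) μ) (hu₀ : AEStronglyMeasurable u₀ μ)
    (hw : AEStronglyMeasurable w μ) (hu2 : ∀ n, eLpNorm (u n) 2 μ < ∞)
    (hu₀2 : eLpNorm u₀ 2 μ < ∞) (hw2 : eLpNorm w 2 μ < ∞)
    (hlim : Tendsto (fun n => eLpNorm (u n - u₀) 2 μ) atTop (𝓝 0)) :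
    Tendsto (fun n => ∫ x, ⟪u n x, w x⟫ ∂μ) atTop (𝓝 (∫ x, ⟪u₀ x, w x⟫ ∂μ)) := by
  have hdiff : ∀ n, (∫ x, ⟪u n x, w x⟫ ∂μ) - ∫ x, ⟪u₀ x, w x⟫ ∂μ =
      ∫ x, ⟪u n x - u₀ x, w x⟫ ∂μ := by
    intro n
    rw [← integral_sub (FunctionSpaces.integrable_inner_of_eLpNorm_two_lt_top (hu n) hw (hu2 n) hw2)
      (FunctionSpaces.integrable_inner_of_eLpNorm_two_lt_top hu₀ hw hu₀2 hw2)]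
    refine integral_congr_ae (Eventually.of_forall fun x => ?_)
    simp only [inner_sub_left]
  -- the `ℝ≥0∞` bound tends to `0`
  have hE : Tendsto (fun n => ‖∫ x, ⟪u n x - u₀ x, w x⟫ ∂μ‖ₑ) atTop (𝓝 0) := by
    have hb : ∀ n, ‖∫ x, ⟪u n x - u₀ x, w x⟫ ∂μ‖ₑ ≤ eLpNorm (u n - u₀) 2 μ * eLpNorm w 2 μ :=
      fun n => FunctionSpaces.enorm_integral_inner_le_eLpNorm_mul ((hu n).sub hu₀) hw
    have hup : Tendsto (fun n => eLpNorm (u n - u₀) 2 μ * eLpNorm w 2 μ) atTop (𝓝 0) := by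
      simpa using ENNReal.Tendsto.mul_const hlim (Or.inr hw2.ne)
    exact tendsto_of_tendsto_of_tendsto_of_le_of_le tendsto_const_nhds hup (fun n => zero_le) hb
  have hR : Tendsto (fun n => ‖∫ x, ⟪u n x - u₀ x, w x⟫ ∂μ‖) atTop (𝓝 0) := by
    have h : Tendsto (fun n => (‖∫ x, ⟪u n x - u₀ x, w x⟫ ∂μ‖ₑ).toReal) atTop
        (𝓝 (0 : ℝ≥0∞).toReal) := (ENNReal.tendsto_toReal ENNReal.zero_ne_top).comp hE
    simpa only [toReal_enorm, ENNReal.toReal_zero] using h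
  rw [tendsto_iff_norm_sub_tendsto_zero]
  simpa only [hdiff] using hR

variable {f : ℝ³ → ℝ³}

/-- **`curl (conePotential f) = f` in `𝒟'(ℝ³)` for weakly divergence-free `f ∈ L²_loc(ℝ³; ℝ³)`**:
for every `Ψ ∈ C¹_c(ℝ³; ℝ³)`, `∫ ⟪conePotential f, curl Ψ⟫ = ∫ ⟪f, Ψ⟫` (Fonda 2018, Thm. 3.31,
extended from solenoidal `C¹` fields by mollification: `fₙ = ρₙ ⋆ f` is smooth with `div fₙ = 0`
pointwise, the identity holds for `fₙ`, and `fₙ → f`, `conePotential fₙ → conePotential f` in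
`L²(B_R) ⊇ supp Ψ`). [cite: Fonda2018, Thm. 3.31] -/
theorem integral_inner_conePotential_curl_of_isWeaklyDivFree (hf : AEStronglyMeasurable f volume)
    (hf2 : LocallyIntegrable (fun x => ‖f x‖ ^ 2) volume) (hdiv : IsWeaklyDivFree f)
    {Ψ : ℝ³ → ℝ³} (hΨ : ContDiff ℝ 1 Ψ) (hΨc : HasCompactSupport Ψ) :
    ∫ x, ⟪conePotential f x, curl Ψ x⟫ = ∫ x, ⟪f x, Ψ x⟫ := by
  -- a ball `B = B_R ⊇ supp Ψ` and the fattened ball `B' = B_{R+1}`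
  obtain ⟨R₀, hR₀⟩ := hΨc.isCompact.isBounded.subset_ball (0 : ℝ³)
  set R : ℝ := max R₀ 1 with hRdef
  have hR : 0 ≤ R := zero_le_one.trans (le_max_right _ _)
  have hsupp : tsupport Ψ ⊆ ball (0 : ℝ³) R := hR₀.trans (ball_subset_ball (le_max_left _ _))
  set B : Set ℝ³ := ball (0 : ℝ³) R with hB
  set B' : Set ℝ³ := ball (0 : ℝ³) (R + 1) with hB'
  set μB : Measure ℝ³ := volume.restrict B with hμB
  have hfloc : LocallyIntegrable f volume := locallyIntegrable_of_locallyIntegrable_sq hf hf2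
  have hfR : ∀ r : ℝ, ∫⁻ x in ball (0 : ℝ³) r, ‖f x‖ₑ ^ 2 < ∞ :=
    fun r => lintegral_ball_enorm_sq_lt_top_of_locallyIntegrable_sq hf2 0 r
  -- mollifiers and the mollified fields
  obtain ⟨φ, hφ0, hφ1⟩ := exists_contDiffBump_seq_rOut_le_one
  set g : ℕ → ℝ³ → ℝ³ := fun n => (φ n).normed volume ⋆[lsmul ℝ ℝ, volume] f with hg
  have hgC : ∀ n, ContDiff ℝ 1 (g n) := fun n =>
    (φ n).hasCompactSupport_normed.contDiff_convolution_left _ (φ n).contDiff_normed hfloc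
  have hgdiv : ∀ n, ∀ y, VectorCalculus.divergence (g n) y = 0 := fun n y =>
    divergence_convolution_eq_zero (φ n).contDiff_normed (φ n).hasCompactSupport_normed hfloc hdiv y
  have hgm : ∀ n, AEStronglyMeasurable (g n) volume := fun n => (hgC n).continuous.aestronglyMeasurable
  have hgR : ∀ n, ∀ r : ℝ, ∫⁻ x in ball (0 : ℝ³) r, ‖g n x‖ₑ ^ 2 < ∞ := fun n r =>
    lintegral_ball_enorm_sq_lt_top_of_locallyIntegrable_sq
      (((hgC n).continuous.norm.pow 2).locallyIntegrable) 0 r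
  -- the smooth identity for each `n`
  have hid : ∀ n, ∫ x, ⟪conePotential (g n) x, curl Ψ x⟫ = ∫ x, ⟪g n x, Ψ x⟫ := fun n =>
    integral_inner_conePotential_curl (hgC n) (hgdiv n) hΨ hΨc
  -- Step 1: `gₙ → f` in `L²(B)` via the truncation `f̃ = 1_{B'} f ∈ L²`
  set ft : ℝ³ → ℝ³ := B'.indicator f with hft
  have hft2 : MemLp ft 2 volume := by
    refine ⟨hf.indicator measurableSet_ball, ?_⟩
    rw [eLpNorm_lt_top_iff_lintegral_rpow_enorm_lt_top two_ne_zero ENNReal.ofNat_ne_top,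
      ENNReal.toReal_ofNat]
    have h : ∀ x, ‖ft x‖ₑ ^ (2 : ℝ) = B'.indicator (fun x => ‖f x‖ₑ ^ 2) x := fun x => by
      rw [ENNReal.rpow_two, hft]
      by_cases hx : x ∈ B'
      · rw [indicator_of_mem hx, indicator_of_mem hx]
      · rw [indicator_of_notMem hx, indicator_of_notMem hx]
        simp
    rw [lintegral_congr h, lintegral_indicator measurableSet_ball]
    exact hfR _
  have hconv := FunctionSpaces.tendsto_eLpNorm_normed_convolution_sub_self (μ := volume) hφ0
    one_le_two ENNReal.ofNat_ne_top hft2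
  have hloc : ∀ n, ∀ x ∈ B, ((φ n).normed volume ⋆[lsmul ℝ ℝ, volume] ft) x - ft x =
      g n x - f x := by
    intro n x hx
    have hxB' : ball x (φ n).rOut ⊆ B' := by
      intro y hy
      rw [hB', mem_ball_zero_iff]
      have h1 : ‖y‖ ≤ ‖y - x‖ + ‖x‖ := norm_le_norm_sub_add y x
      have h2 : ‖y - x‖ < (φ n).rOut := by rwa [mem_ball, dist_eq_norm] at hy
      have h3 : ‖x‖ < R := mem_ball_zero_iff.1 hx
      linarith [hφ1 n]
    have hball : ∀ y ∈ ball x (φ n).rOut, ft y = f y := fun y hy => by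
      rw [hft, indicator_of_mem (hxB' hy)]
    rw [normed_convolution_congr_of_eqOn_ball (φ n) hball, hft,
      indicator_of_mem (hxB' (mem_ball_self (φ n).rOut_pos))]
  have hL2 : Tendsto (fun n => eLpNorm (g n - f) 2 μB) atTop (𝓝 0) := by
    refine tendsto_of_tendsto_of_tendsto_of_le_of_le tendsto_const_nhds hconv
      (fun n => zero_le) fun n => ?_
    have hcongr : eLpNorm (g n - f) 2 μB =
        eLpNorm ((φ n).normed volume ⋆[lsmul ℝ ℝ, volume] ft - ft) 2 μB := by
      refine eLpNorm_congr_ae ?_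
      filter_upwards [ae_restrict_mem measurableSet_ball] with x hx
      simp only [Pi.sub_apply, hloc n x hx]
    rw [hcongr]
    exact eLpNorm_mono_measure _ Measure.restrict_le_self
  -- Step 2: `conePotential gₙ → conePotential f` in `L²(B)`
  have hKL2 : Tendsto (fun n => eLpNorm (conePotential (g n) - conePotential f) 2 μB) atTop (𝓝 0) :=
    tendsto_eLpNorm_conePotential_sub hf hfR hgm hgR hR hL2
  -- Step 3: pass to the limit on both sides (all pairings live on `B`)
  have hΨ2 : eLpNorm Ψ 2 μB < ∞ :=
    ((hΨ.continuous.memLp_of_hasCompactSupport (μ := volume) hΨc).restrict B).eLpNorm_lt_top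
  have hcΨ2 : eLpNorm (curl Ψ) 2 μB < ∞ :=
    (((continuous_curl hΨ).memLp_of_hasCompactSupport (μ := volume)
      (hasCompactSupport_curl hΨc)).restrict B).eLpNorm_lt_top
  have h2 : ∀ {u : ℝ³ → ℝ³}, ∫⁻ x in B, ‖u x‖ₑ ^ 2 < ∞ → eLpNorm u 2 μB < ∞ := by
    intro u hu
    by_contra htop
    rw [not_lt, top_le_iff] at htop
    have h := eLpNorm_two_pow_two (μ := μB) u
    rw [htop, ENNReal.top_pow two_ne_zero] at h
    exact hu.ne h.symm
  have hf2B : eLpNorm f 2 μB < ∞ := h2 (hfR R)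
  have hg2B : ∀ n, eLpNorm (g n) 2 μB < ∞ := fun n => h2 (hgR n R)
  have hKf2B : eLpNorm (conePotential f) 2 μB < ∞ :=
    h2 (lintegral_ball_enorm_conePotential_sq_lt_top hf (hfR R))
  have hKg2B : ∀ n, eLpNorm (conePotential (g n)) 2 μB < ∞ := fun n =>
    h2 (lintegral_ball_enorm_conePotential_sq_lt_top (hgm n) (hgR n R))
  -- restrict the pairings to `B`
  have hrestr : ∀ (u w : ℝ³ → ℝ³), (∀ x ∉ B, w x = 0) →
      ∫ x, ⟪u x, w x⟫ = ∫ x in B, ⟪u x, w x⟫ := fun u w hw =>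
    (setIntegral_eq_integral_of_forall_compl_eq_zero fun x hx => by simp [hw x hx]).symm
  have hΨ0 : ∀ x ∉ B, Ψ x = 0 := fun x hx =>
    image_eq_zero_of_notMem_tsupport fun h => hx (hsupp h)
  have hcΨ0 : ∀ x ∉ B, curl Ψ x = 0 := fun x hx =>
    curl_eq_zero_of_notMem_tsupport fun h => hx (hsupp h)
  -- the two limits
  have hlimL : Tendsto (fun n => ∫ x in B, ⟪conePotential (g n) x, curl Ψ x⟫) atTop
      (𝓝 (∫ x in B, ⟪conePotential f x, curl Ψ x⟫)) :=
    tendsto_integral_inner_of_tendsto_eLpNorm_sub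
      (fun n => (aestronglyMeasurable_conePotential (hgm n)).restrict)
      (aestronglyMeasurable_conePotential hf).restrict
      (continuous_curl hΨ).aestronglyMeasurable.restrict hKg2B hKf2B hcΨ2 hKL2
  have hlimR : Tendsto (fun n => ∫ x in B, ⟪g n x, Ψ x⟫) atTop (𝓝 (∫ x in B, ⟪f x, Ψ x⟫)) :=
    tendsto_integral_inner_of_tendsto_eLpNorm_sub (fun n => (hgm n).restrict) hf.restrict
      hΨ.continuous.aestronglyMeasurable.restrict hg2B hf2B hΨ2 hL2
  have heq : (fun n => ∫ x in B, ⟪conePotential (g n) x, curl Ψ x⟫) =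
      fun n => ∫ x in B, ⟪g n x, Ψ x⟫ := by
    funext n
    rw [← hrestr _ _ hcΨ0, ← hrestr _ _ hΨ0, hid n]
  rw [hrestr _ _ hcΨ0, hrestr _ _ hΨ0]
  rw [heq] at hlimL
  exact tendsto_nhds_unique hlimL hlimR

/-- The cone potential of an `L²_loc` field is locally integrable. [folklore] -/
theorem locallyIntegrable_conePotential (hf : AEStronglyMeasurable f volume)
    (hf2 : LocallyIntegrable (fun x => ‖f x‖ ^ 2) volume) :
    LocallyIntegrable (conePotential f) volume :=
  locallyIntegrable_of_lintegral_ball_sq_lt_top (aestronglyMeasurable_conePotential hf) fun R =>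
    lintegral_ball_enorm_conePotential_sq_lt_top hf
      (lintegral_ball_enorm_sq_lt_top_of_locallyIntegrable_sq hf2 0 R)

end Distributional

/-! ## The divergence-free cut-off -/

section Cutoff

variable {f : ℝ³ → ℝ³}

/-- The gradient of a `C²` function is `C¹`. [folklore] -/
theorem contDiff_one_gradient {θ : ℝ³ → ℝ} (hθ : ContDiff ℝ 2 θ) : ContDiff ℝ 1 (gradient θ) := by
  show ContDiff ℝ 1 fun x => (InnerProductSpace.toDual ℝ ℝ³).symm (fderiv ℝ θ x)
  exact (InnerProductSpace.toDual ℝ ℝ³).symm.contDiff.comp (hθ.fderiv_right (m := 1) (by norm_num))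

/-- Pairings of a locally integrable field with a continuous compactly supported field are
integrable. [folklore] -/
theorem integrable_inner_of_locallyIntegrable {u w : ℝ³ → ℝ³} (hu : LocallyIntegrable u volume)
    (hw : Continuous w) (hwc : HasCompactSupport w) :
    Integrable (fun x => ⟪u x, w x⟫) volume := by
  have hmaj : Integrable (fun x => ‖w x‖ • u x) volume :=
    hu.integrable_smul_left_of_hasCompactSupport hw.norm hwc.norm
  refine hmaj.norm.mono' (hu.aestronglyMeasurable.inner hw.aestronglyMeasurable)
    (Eventually.of_forall fun x => ?_)
  rw [norm_smul, norm_norm, mul_comm]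
  exact norm_inner_le_norm _ _

/-- **The divergence-free cut-off of a divergence-free field.** Let `f ∈ L²_loc(ℝ³; ℝ³)` be weakly
divergence free and let `ζ ∈ C²_c(ℝ³)`. Then the compactly supported field
`ζ f + ∇ζ × conePotential f` — formally `curl (ζ · conePotential f)`, since
`curl (conePotential f) = f` — is weakly divergence free:
`∫ ⟪ζ f + ∇ζ × conePotential f, ∇θ⟫ = 0` for every test function `θ`. (Test the distributional
identity `integral_inner_conePotential_curl_of_isWeaklyDivFree` with `Ψ = ζ ∇θ`, whose curl is
`∇ζ × ∇θ`, and use `⟪K f, ∇ζ × ∇θ⟫ = −⟪∇ζ × K f, ∇θ⟫`.) An explicit, scaling-covariant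
alternative to the Bogovskiĭ correction `Φ₀` of `Z₀ f` in the printed proof of Bradshaw–Tsai 2019,
Lemma 4.1 ("`∇·(Z₀ f + Φ₀) = 0`", arXiv:1801.08060 p. 11). [cite: BradshawTsai2019, Lemma 4.1 (proof)] -/
theorem isWeaklyDivFree_cutoff_conePotential (hf : AEStronglyMeasurable f volume)
    (hf2 : LocallyIntegrable (fun x => ‖f x‖ ^ 2) volume) (hdiv : IsWeaklyDivFree f)
    {ζ : ℝ³ → ℝ} (hζ : ContDiff ℝ 2 ζ) (hζc : HasCompactSupport ζ) :
    IsWeaklyDivFree fun x => ζ x • f x + cross (gradient ζ x) (conePotential f x) := by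
  intro θ hθ
  have hθ2 : ContDiff ℝ 2 θ := contDiff_infty.1 hθ.contDiff 2
  have hgradθ : ContDiff ℝ 1 (gradient θ) := contDiff_one_gradient hθ2
  have hgradζc : Continuous (gradient ζ) := continuous_gradient_of_contDiff (hζ.of_le one_le_two)
  have hgradθc : Continuous (gradient θ) := hgradθ.continuous
  have hgradθs : HasCompactSupport (gradient θ) :=
    (hθ.hasCompactSupport.fderiv (𝕜 := ℝ)).comp_left (map_zero _)
  have hfloc : LocallyIntegrable f volume := locallyIntegrable_of_locallyIntegrable_sq hf hf2
  have hKloc : LocallyIntegrable (conePotential f) volume := locallyIntegrable_conePotential hf hf2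
  -- the test field `Ψ = ζ ∇θ` and its curl
  set Ψ : ℝ³ → ℝ³ := fun x => ζ x • gradient θ x with hΨdef
  have hΨ : ContDiff ℝ 1 Ψ := (hζ.of_le one_le_two).smul hgradθ
  have hΨc : HasCompactSupport Ψ := hζc.smul_right
  have hcurl : ∀ x, curl Ψ x = cross (gradient ζ x) (gradient θ x) := fun x => by
    rw [hΨdef, curl_smul (hζ.differentiable two_ne_zero x) (hgradθ.differentiable one_ne_zero x),
      curl_gradient_eq_zero_holds θ hθ2 x, smul_zero, zero_add, curlCLM_smulRight]
    rfl
  have hmain := integral_inner_conePotential_curl_of_isWeaklyDivFree hf hf2 hdiv hΨ hΨc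
  -- integrability of the two pieces
  have hI1 : Integrable (fun x => ⟪ζ x • f x, gradient θ x⟫) volume := by
    have h := integrable_inner_of_locallyIntegrable hfloc hΨ.continuous hΨc
    refine h.congr (Eventually.of_forall fun x => ?_)
    simp only [hΨdef, real_inner_smul_left, real_inner_smul_right]
  have hI2 : Integrable (fun x => ⟪cross (gradient ζ x) (conePotential f x), gradient θ x⟫) volume := by
    have hmaj : Integrable (fun x => (‖gradient ζ x‖ * ‖gradient θ x‖) • conePotential f x)
        volume :=
      hKloc.integrable_smul_left_of_hasCompactSupport (hgradζc.norm.mul hgradθc.norm)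
        (hgradθs.norm.mul_left)
    refine hmaj.norm.mono' ?_ (Eventually.of_forall fun x => ?_)
    · exact (crossCLM.continuous₂.comp_aestronglyMeasurable₂ hgradζc.aestronglyMeasurable
        hKloc.aestronglyMeasurable).inner hgradθc.aestronglyMeasurable
    · calc ‖⟪cross (gradient ζ x) (conePotential f x), gradient θ x⟫‖
          ≤ ‖cross (gradient ζ x) (conePotential f x)‖ * ‖gradient θ x‖ := norm_inner_le_norm _ _
        _ ≤ ‖gradient ζ x‖ * ‖conePotential f x‖ * ‖gradient θ x‖ :=
            mul_le_mul_of_nonneg_right (norm_cross_le _ _) (norm_nonneg _)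
        _ = ‖(‖gradient ζ x‖ * ‖gradient θ x‖) • conePotential f x‖ := by
            rw [norm_smul, Real.norm_eq_abs, abs_of_nonneg (by positivity)]; ring
  -- the computation
  have hsplit : ∫ x, ⟪ζ x • f x + cross (gradient ζ x) (conePotential f x), gradient θ x⟫ =
      (∫ x, ⟪ζ x • f x, gradient θ x⟫) +
        ∫ x, ⟪cross (gradient ζ x) (conePotential f x), gradient θ x⟫ := by
    rw [← integral_add hI1 hI2]
    refine integral_congr_ae (Eventually.of_forall fun x => ?_)
    simp only [inner_add_left]
  have h1 : ∫ x, ⟪ζ x • f x, gradient θ x⟫ = ∫ x, ⟪conePotential f x, curl Ψ x⟫ := by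
    rw [hmain]
    refine integral_congr_ae (Eventually.of_forall fun x => ?_)
    simp only [hΨdef, real_inner_smul_left, real_inner_smul_right]
  have h2 : ∫ x, ⟪conePotential f x, curl Ψ x⟫ =
      -∫ x, ⟪cross (gradient ζ x) (conePotential f x), gradient θ x⟫ := by
    rw [← integral_neg]
    refine integral_congr_ae (Eventually.of_forall fun x => ?_)
    dsimp only
    rw [hcurl x, inner_cross_right_eq_neg_inner_cross_left]
  rw [hsplit, h1, h2, neg_add_cancel]

end Cutoff


end Literature.Analysis.FluidPDE

end
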